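import Summits.CriticalPhenomena.SAWScalingLimit.Theses.SAWTwistedSelfEnergy
import Summits.CriticalPhenomena.SAWScalingLimit.Theses.SAWRenewalTightness
import Summits.CriticalPhenomena.SAWScalingLimit.Theses.SAWParafermion
import Summits.CriticalPhenomena.SAWScalingLimit.Theses.SAWLaplacianWalk
import Summits.CriticalPhenomena.SAWScalingLimit.Theses.SAWConfRestriction
import Summits.CriticalPhenomena.SAWScalingLimit.Theorems.SAWTwistedSelfEnergySubseqIdentificationExistsLatticeRooted
import Summits.CriticalPhenomena.SAWScalingLimit.Theorems.SAWTwistedSelfEnergySubseqIdentificationParaDoobMartingale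
import Summits.CriticalPhenomena.SAWScalingLimit.Theorems.SAWTwistedSelfEnergySubseqIdentificationParaExplorationData
import Summits.CriticalPhenomena.SAWScalingLimit.Theorems.SAWTwistedSelfEnergySubseqIdentificationParaCharacterisesSLE
import Summits.CriticalPhenomena.SAWScalingLimit.Theorems.SAWRenewalTightnessSubseqIdentificationSawNoReturn
import Literature.Probability.RandomPlanarGeometry.SAWExplorationRunningMax
import Literature.Probability.Process.StoppedValuePairing
import HarnessLib

/-!
# Reduction of the crux `SubseqIdentification` (stmt-CriticalPhenomena-0783) to the convergence of the
# route's own observable: `S2 → S3a → S3c → LimitsDescribable → EndpointRobust → SubseqIdentification`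

Line `parafermionic-martingale` (lead c6; skeleton `Cruxes/SubseqIdentification/Lines/parafermionic_martingale.lean`,
reshape r-c6-3). This file LANDS the line's composition as a theorem of the tree over the statements that are
still open, so that the route `SAWTwistedSelfEnergy` (whose `closes` consumed `SubseqIdentification` with no typed
link to its observable engine — crux-attack report 2026-08-17) now has a kernel-checked glue from an OBSERVABLE
statement to the crux:

* `S2`  — slit-uniform, normalisation-free convergence of the Doob-normalised spin-5/8 observable `paraDoob` to the
  hull functional `hullParaObs` at capped pasts off the no-return event (Duminil-Copin–Smirnov Conjecture 2 in
  ratio form on `δℤ²`; the honest output the route's engine `DomainTransfer` must deliver);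
* `S3a` — threshold-`S₀` approximate lattice drivers with para fidelity (generic lattice Loewner theory, the
  para twin of the room line's `SAWLatticeDriversApprox`);
* `S3c` — the diagonal passage assembly (provable; port of `stub_roomPassageAssemblyNRPos`);
* `LimitsDescribable` (stmt-CriticalPhenomena-4481, NECESSARY for the crux) and `EndpointRobust`
  (stmt-CriticalPhenomena-0776), the shared route items, BY NAME.

PROVED inputs used: S1 `stub_paraDoobMartingale` (p167616), S3b `stub_paraExplorationData` (p167838), S4
`stub_paraObservableCharacterisesSLECap` (p168572), S5 `stub_existsRootedApprox` (p166209), no-return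
`RoomEntropy.stub_sawNoReturn` (p118403), `MarkedDomain.exists_isChordalUniformizing_holds`. Axioms `propext`,
`Classical.choice`, `Quot.sound`; no `sorry`; the three open statements enter only as hypotheses.
-/

noncomputable section

open MeasureTheory Filter Topology Set
open scoped NNReal ENNReal Classical BigOperators
open Literature.Probability.LatticeModels
open Literature.Probability.RandomPlanarGeometry
open UpperHalfPlane (upperHalfPlaneSet)
open scoped PathBorel

namespace Summit.CriticalPhenomena.SAWScalingLimit.Theorems.SubseqIdentification.ParaMartingale

open Summit.CriticalPhenomena.SAWScalingLimit.Theses.SAWTwistedSelfEnergy (SubseqIdentification)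
open Summit.CriticalPhenomena.SAWScalingLimit.Theses.SAWLaplacianWalk (LimitsDescribable)
open Summit.CriticalPhenomena.SAWScalingLimit.Theses.SAWConfRestriction (EndpointRobust)
open Summit.CriticalPhenomena.SAWScalingLimit.Theorems.SubseqIdentification.RoomEntropy
  (prefixAt capTimeOf noReturnEvent WeakLimitAlong NoReturnAlong frozenDriver)

/-- **Transfer of a subsequential weak limit between endpoint approximations** (from `EndpointRobust`, stmt-0776):
if the pushed SAW curve laws of `(a_δ, b_δ)` converge along `s → 0⁺` against a bounded continuous `f`, so do those of any
other endpoint approximation `(a₁_δ, b₁_δ)` of the same Dobrushin domain, to the same limit. [folklore] -/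
theorem tendsto_integral_of_endpointRobust (hE : EndpointRobust) {D : DobrushinDomain} {a b a₁ b₁ : ℝ → Site 2}
    (hab : SAW.IsEndpointApprox D a b) (hab₁ : SAW.IsEndpointApprox D a₁ b₁) {s : ℕ → ℝ}
    (hs : Tendsto s atTop (𝓝[>] (0 : ℝ))) {L : ℝ} (f : BoundedContinuousFunction (CurveClass ℂ) ℝ)
    (hlim : Tendsto (fun n => ∫ γ, f γ.curve ∂(SAW.law D.carrier (s n) (a (s n)) (b (s n)))) atTop (𝓝 L)) :
    Tendsto (fun n => ∫ γ, f γ.curve ∂(SAW.law D.carrier (s n) (a₁ (s n)) (b₁ (s n)))) atTop (𝓝 L) := by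
  have h2 := (hE D a b a₁ b₁ hab hab₁ f).comp hs
  have h3 := hlim.sub h2
  simp only [sub_zero] at h3
  refine h3.congr' (Eventually.of_forall fun n => ?_)
  simp only [Function.comp_apply, sub_sub_cancel]

/-- **`SubseqIdentification` from the convergence of the route's own observable** (line
`parafermionic-martingale`, kernel-checked reduction): S2 (slit-uniform convergence of the Doob-normalised
spin-5/8 observable) → S3a (approximate lattice drivers with para fidelity) → S3c (the diagonal passage
assembly) → `LimitsDescribable` → `EndpointRobust` → `SubseqIdentification`. Proof: given a probability weak
limit `μ` of the SAW curve laws of `(D; a, b)` along `s → 0⁺`, pick a lattice-rooted approximation of `D` (S5,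
PROVED), transfer the weak limit to it (`EndpointRobust`), describe `μ`-a.e. class from `a` through a chordal
uniformizer (`LimitsDescribable`), run the passage S3c over S3a, S3b (PROVED), S1 (PROVED), S2 and no-return
(`stub_sawNoReturn`, PROVED from `LimitsDescribable`) to get the capped parafermionic martingales, and identify `μ`
by the capped endgame S4 (PROVED). [folklore] -/
theorem SubseqIdentification_of_paraObservable :
    (∀ (D : DobrushinDomain) (a a' b : ℝ → Site 2) (φ : ConformalEquiv upperHalfPlaneSet D.carrier),
        IsLatticeRooted D a a' b → D.IsChordalUniformizing φ →
        ∀ w : ℂ, 0 < w.im → ∀ (zδ : ℝ → Site 2),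
          Tendsto (fun δ => meshPoint δ (zδ δ)) (𝓝[>] (0 : ℝ)) (𝓝 (φ w)) →
          (∃ C : ℝ, ∀ᶠ δ in 𝓝[>] (0 : ℝ), ∀ (γ : SAW.DomainSAW D.carrier δ (a δ) (b δ)) (k : ℕ),
              LatticeSlit.capTime φ (prefixAt γ k) ≤ w.im ^ 2 / 16 →
              ‖paraDoob D δ (a δ) (a' δ) (b δ) (zδ δ) γ k‖ ≤ C) ∧
          ∀ ε : ℝ, 0 < ε → ∃ R : ℝ, 0 < R ∧ ∀ r : ℝ, 0 < r → r < R → ∀ᶠ δ in 𝓝[>] (0 : ℝ),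
            ∀ (γ : SAW.DomainSAW D.carrier δ (a δ) (b δ)), γ ∉ noReturnEvent D δ (a δ) (b δ) R r →
              ∀ k : ℕ, LatticeSlit.capTime φ (prefixAt γ k) ≤ w.im ^ 2 / 16 →
                ‖paraDoob D δ (a δ) (a' δ) (b δ) (zδ δ) γ k -
                    hullParaObs (LatticeSlit.pastHull φ (prefixAt γ k)) (LatticeSlit.drivingValue φ (prefixAt γ k)) w‖
                  ≤ ε) →
    (∀ (D : DobrushinDomain) (a b : ℝ → Site 2) (φ : ConformalEquiv upperHalfPlaneSet D.carrier),
          SAW.IsEndpointApprox D a b → D.IsChordalUniformizing φ →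
          ∀ ρ : ℝ, 0 < ρ → ∀ (μ : Measure (CurveClass ℂ)) (s : ℕ → ℝ) [IsProbabilityMeasure μ]
            [∀ n, IsProbabilityMeasure (SAW.law D.carrier (s n) (a (s n)) (b (s n)))],
            Tendsto s atTop (𝓝[>] (0 : ℝ)) → WeakLimitAlong D a b μ s →
            (∀ᵐ c ∂μ, IsLoewnerDescribable φ c ∧ c.source = D.pt 0) → NoReturnAlong D a b s →
            ∃ S₀ : ℝ≥0, 0 < S₀ ∧ (S₀ : ℝ) ≤ ρ ∧
            ∃ 𝒱 : (δ : ℝ) → SAW.DomainSAW D.carrier δ (a δ) (b δ) → C(ℝ≥0, ℝ),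
              (∀ᶠ n in atTop, ∀ (γ γ' : SAW.DomainSAW D.carrier (s n) (a (s n)) (b (s n))) (k : ℕ),
                (prefixAt γ k).support = (prefixAt γ' k).support →
                (S₀ : ℝ) ≤ LatticeSlit.capTime φ (prefixAt γ k) →
                ∀ u : ℝ≥0, (u : ℝ) ≤ LatticeSlit.capTime φ (prefixAt γ k) →
                  𝒱 (s n) γ u = 𝒱 (s n) γ' u) ∧
              TendstoInDistribution (fun n γ => 𝒱 (s n) γ) atTop (frozenDriver φ S₀)
                (fun n => SAW.law D.carrier (s n) (a (s n)) (b (s n))) μ ∧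
              (∀ w : ℂ, ρ ≤ w.im → ∀ᶠ n in atTop,
                SAW.law D.carrier (s n) (a (s n)) (b (s n))
                  {γ | ∃ k : ℕ, (S₀ : ℝ) ≤ LatticeSlit.capTime φ (prefixAt γ k) ∧
                    LatticeSlit.capTime φ (prefixAt γ k) ≤ w.im ^ 2 / 16 ∧
                    ρ < ‖paraObsCap (𝒱 (s n) γ) w (LatticeSlit.capTime φ (prefixAt γ k)).toNNReal -
                      hullParaObs (LatticeSlit.pastHull φ (prefixAt γ k))
                        (LatticeSlit.drivingValue φ (prefixAt γ k)) w‖}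
                  ≤ ENNReal.ofReal ρ) ∧
              ∀ T ε : ℝ, 0 < ε → ∀ᶠ n in atTop,
                SAW.law D.carrier (s n) (a (s n)) (b (s n))
                  {γ | (∀ k : ℕ, LatticeSlit.capTime φ (prefixAt γ k) ≤ T) ∨
                    ∃ (k : ℕ) (u : Site 2), LatticeSlit.capTime φ (prefixAt γ k) ≤ T ∧
                      ε < LatticeSlit.capIncrement φ (prefixAt γ k) u} ≤ ENNReal.ofReal ε) →
    ((∀ (D : DobrushinDomain) (a b : ℝ → Site 2) (φ : ConformalEquiv upperHalfPlaneSet D.carrier),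
            SAW.IsEndpointApprox D a b → D.IsChordalUniformizing φ →
            ∀ ρ : ℝ, 0 < ρ → ∀ (μ : Measure (CurveClass ℂ)) (s : ℕ → ℝ) [IsProbabilityMeasure μ]
              [∀ n, IsProbabilityMeasure (SAW.law D.carrier (s n) (a (s n)) (b (s n)))],
              Tendsto s atTop (𝓝[>] (0 : ℝ)) → WeakLimitAlong D a b μ s →
              (∀ᵐ c ∂μ, IsLoewnerDescribable φ c ∧ c.source = D.pt 0) → NoReturnAlong D a b s →
              ∃ S₀ : ℝ≥0, 0 < S₀ ∧ (S₀ : ℝ) ≤ ρ ∧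
              ∃ 𝒱 : (δ : ℝ) → SAW.DomainSAW D.carrier δ (a δ) (b δ) → C(ℝ≥0, ℝ),
                (∀ᶠ n in atTop, ∀ (γ γ' : SAW.DomainSAW D.carrier (s n) (a (s n)) (b (s n))) (k : ℕ),
                  (prefixAt γ k).support = (prefixAt γ' k).support →
                  (S₀ : ℝ) ≤ LatticeSlit.capTime φ (prefixAt γ k) →
                  ∀ u : ℝ≥0, (u : ℝ) ≤ LatticeSlit.capTime φ (prefixAt γ k) →
                    𝒱 (s n) γ u = 𝒱 (s n) γ' u) ∧
                TendstoInDistribution (fun n γ => 𝒱 (s n) γ) atTop (frozenDriver φ S₀)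
                  (fun n => SAW.law D.carrier (s n) (a (s n)) (b (s n))) μ ∧
                (∀ w : ℂ, ρ ≤ w.im → ∀ᶠ n in atTop,
                  SAW.law D.carrier (s n) (a (s n)) (b (s n))
                    {γ | ∃ k : ℕ, (S₀ : ℝ) ≤ LatticeSlit.capTime φ (prefixAt γ k) ∧
                      LatticeSlit.capTime φ (prefixAt γ k) ≤ w.im ^ 2 / 16 ∧
                      ρ < ‖paraObsCap (𝒱 (s n) γ) w (LatticeSlit.capTime φ (prefixAt γ k)).toNNReal -
                        hullParaObs (LatticeSlit.pastHull φ (prefixAt γ k))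
                          (LatticeSlit.drivingValue φ (prefixAt γ k)) w‖}
                    ≤ ENNReal.ofReal ρ) ∧
                ∀ T ε : ℝ, 0 < ε → ∀ᶠ n in atTop,
                  SAW.law D.carrier (s n) (a (s n)) (b (s n))
                    {γ | (∀ k : ℕ, LatticeSlit.capTime φ (prefixAt γ k) ≤ T) ∨
                      ∃ (k : ℕ) (u : Site 2), LatticeSlit.capTime φ (prefixAt γ k) ≤ T ∧
                        ε < LatticeSlit.capIncrement φ (prefixAt γ k) u} ≤ ENNReal.ofReal ε) →
      (∀ (D : DobrushinDomain) (δ : ℝ) (a a' b z : Site 2)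
            (φ : ConformalEquiv upperHalfPlaneSet D.carrier)
            [Finite (SAW.DomainSAW D.carrier δ a b)] [IsProbabilityMeasure (SAW.law D.carrier δ a b)]
            (V : SAW.DomainSAW D.carrier δ a b → C(ℝ≥0, ℝ)) (T θ : ℝ) (S₀ s₁ t₁ : ℝ≥0),
            0 ≤ θ → 0 < S₀ → S₀ ≤ s₁ → s₁ ≤ t₁ → (t₁ : ℝ) + 2 * θ ≤ T →
            (∀ (n : ℕ) (l : List (Site 2)), z ∉ l → l.length = n + 1 →
              (∀ v u : Site 2, l.getLast? = some v → (discreteDomainGraph D.carrier δ).Adj v u → u ∉ l →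
                (∃ ω : SAW.DomainSAW D.carrier δ u z, ∀ y ∈ ω.walk.support, y ∉ l) →
                ∃ ω : SAW.DomainSAW D.carrier δ u b, ∀ y ∈ ω.walk.support, y ∉ l) →
              ∫ γ in {γ : SAW.DomainSAW D.carrier δ a b | γ.walk.support.take (n + 1) = l},
                  paraDoob D δ a a' b z γ (n + 1) ∂(SAW.law D.carrier δ a b) =
                ∫ γ in {γ : SAW.DomainSAW D.carrier δ a b | γ.walk.support.take (n + 1) = l},
                  paraDoob D δ a a' b z γ n ∂(SAW.law D.carrier δ a b)) →
            (∀ γ : SAW.DomainSAW D.carrier δ a b, LatticeSlit.capTime φ (prefixAt γ 0) ≤ θ) →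
            (∀ (γ γ' : SAW.DomainSAW D.carrier δ a b) (k : ℕ),
              (prefixAt γ k).support = (prefixAt γ' k).support →
              (S₀ : ℝ) ≤ LatticeSlit.capTime φ (prefixAt γ k) →
              ∀ u : ℝ≥0, (u : ℝ) ≤ LatticeSlit.capTime φ (prefixAt γ k) → V γ u = V γ' u) →
            ∃ (𝒢 : Filtration ℕ (inferInstance : MeasurableSpace (SAW.DomainSAW D.carrier δ a b)))
              (σ τ : SAW.DomainSAW D.carrier δ a b → WithTop ℕ) (hσ : IsStoppingTime 𝒢 σ) (M : ℕ)
              (G : ℕ → SAW.DomainSAW D.carrier δ a b → ℂ),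
              IsStoppingTime 𝒢 τ ∧ Martingale G 𝒢 (SAW.law D.carrier δ a b) ∧ σ ≤ τ ∧ (∀ γ, τ γ ≤ M) ∧
              (∀ u, u ≤ s₁ → Measurable[hσ.measurableSpace] fun γ => V γ u) ∧
              (∀ (n : ℕ) (γ : SAW.DomainSAW D.carrier δ a b), ∃ k : ℕ,
                G n γ = paraDoob D δ a a' b z γ k ∧ LatticeSlit.capTime φ (prefixAt γ k) ≤ T) ∧
              ∀ γ : SAW.DomainSAW D.carrier δ a b,
                γ ∉ {γ : SAW.DomainSAW D.carrier δ a b |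
                      (∀ k : ℕ, LatticeSlit.capTime φ (prefixAt γ k) ≤ T) ∨
                      ∃ (k : ℕ) (u : Site 2), LatticeSlit.capTime φ (prefixAt γ k) ≤ T ∧
                        θ < LatticeSlit.capIncrement φ (prefixAt γ k) u} →
                ∃ j k : ℕ, σ γ = j ∧ τ γ = k ∧
                  (s₁ : ℝ) ≤ LatticeSlit.capTime φ (prefixAt γ j) ∧
                  LatticeSlit.capTime φ (prefixAt γ j) ≤ s₁ + θ ∧
                  (t₁ : ℝ) ≤ LatticeSlit.capTime φ (prefixAt γ k) ∧
                  LatticeSlit.capTime φ (prefixAt γ k) ≤ t₁ + θ ∧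
                  (stoppedValue G σ γ = paraDoob D δ a a' b z γ j ∧
                      stoppedValue G τ γ = paraDoob D δ a a' b z γ k ∨
                    paraDoob D δ a a' b z γ k = 0)) →
      (∀ (D : DobrushinDomain) (δ : ℝ) (a a' b z : Site 2) (n : ℕ) (l : List (Site 2)), 0 < δ → z ∉ l →
          l.length = n + 1 →
          (∀ v u : Site 2, l.getLast? = some v → (discreteDomainGraph D.carrier δ).Adj v u → u ∉ l →
            (∃ ω : SAW.DomainSAW D.carrier δ u z, ∀ y ∈ ω.walk.support, y ∉ l) →
            ∃ ω : SAW.DomainSAW D.carrier δ u b, ∀ y ∈ ω.walk.support, y ∉ l) →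
          ∫ γ in {γ : SAW.DomainSAW D.carrier δ a b | γ.walk.support.take (n + 1) = l},
              paraDoob D δ a a' b z γ (n + 1) ∂(SAW.law D.carrier δ a b) =
            ∫ γ in {γ : SAW.DomainSAW D.carrier δ a b | γ.walk.support.take (n + 1) = l},
              paraDoob D δ a a' b z γ n ∂(SAW.law D.carrier δ a b)) →
      (∀ (D : DobrushinDomain) (a a' b : ℝ → Site 2) (φ : ConformalEquiv upperHalfPlaneSet D.carrier),
          IsLatticeRooted D a a' b → D.IsChordalUniformizing φ →
          ∀ w : ℂ, 0 < w.im → ∀ (zδ : ℝ → Site 2),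
            Tendsto (fun δ => meshPoint δ (zδ δ)) (𝓝[>] (0 : ℝ)) (𝓝 (φ w)) →
            (∃ C : ℝ, ∀ᶠ δ in 𝓝[>] (0 : ℝ), ∀ (γ : SAW.DomainSAW D.carrier δ (a δ) (b δ)) (k : ℕ),
                LatticeSlit.capTime φ (prefixAt γ k) ≤ w.im ^ 2 / 16 →
                ‖paraDoob D δ (a δ) (a' δ) (b δ) (zδ δ) γ k‖ ≤ C) ∧
            ∀ ε : ℝ, 0 < ε → ∃ R : ℝ, 0 < R ∧ ∀ r : ℝ, 0 < r → r < R → ∀ᶠ δ in 𝓝[>] (0 : ℝ),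
              ∀ (γ : SAW.DomainSAW D.carrier δ (a δ) (b δ)), γ ∉ noReturnEvent D δ (a δ) (b δ) R r →
                ∀ k : ℕ, LatticeSlit.capTime φ (prefixAt γ k) ≤ w.im ^ 2 / 16 →
                  ‖paraDoob D δ (a δ) (a' δ) (b δ) (zδ δ) γ k -
                      hullParaObs (LatticeSlit.pastHull φ (prefixAt γ k)) (LatticeSlit.drivingValue φ (prefixAt γ k)) w‖
                    ≤ ε) →
      (∀ (D : DobrushinDomain) (a b : ℝ → Site 2), SAW.IsEndpointApprox D a b →
            ∀ (μ : Measure (CurveClass ℂ)) (s : ℕ → ℝ), IsProbabilityMeasure μ →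
              Tendsto s atTop (𝓝[>] (0 : ℝ)) → WeakLimitAlong D a b μ s → NoReturnAlong D a b s) →
      ∀ (D : DobrushinDomain) (a a' b : ℝ → Site 2)
          (φ : ConformalEquiv upperHalfPlaneSet D.carrier) (μ : Measure (CurveClass ℂ)),
          IsLatticeRooted D a a' b → D.IsChordalUniformizing φ → IsProbabilityMeasure μ →
          IsSubseqLimitLaw (fun δ (γ : SAW.DomainSAW D.carrier δ (a δ) (b δ)) => γ.curve)
            (fun δ => SAW.law D.carrier δ (a δ) (b δ)) μ →
          (∀ᵐ c ∂μ, IsLoewnerDescribable φ c ∧ c.source = D.pt 0) →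
          ∃ 𝓕 : Filtration ℝ≥0 (inferInstance : MeasurableSpace (CurveClass ℂ)),
            Adapted 𝓕 (fun t c => drivingFunction φ c t) ∧
            ∀ w : ℂ, 0 < w.im →
              Martingale (fun t c => paraObsCap (drivingFunction φ c) w t) 𝓕 μ) →
    LimitsDescribable → EndpointRobust → SubseqIdentification := by
  intro hO hD hA hR hE D a b hab s μ hs hμ hlim
  obtain ⟨a₁, a₁', b₁, hroot⟩ := stub_existsRootedApprox D a b hab
  -- transfer of the weak limit to the lattice-rooted approximation
  have hlim₁ : ∀ f : BoundedContinuousFunction (CurveClass ℂ) ℝ,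
      Tendsto (fun n => ∫ γ, f γ.curve ∂(SAW.law D.carrier (s n) (a₁ (s n)) (b₁ (s n)))) atTop
        (𝓝 (∫ x, f x ∂μ)) := fun f =>
    tendsto_integral_of_endpointRobust hE hab hroot.1 hs f (hlim f)
  have hsub : IsSubseqLimitLaw (fun δ (γ : SAW.DomainSAW D.carrier δ (a₁ δ) (b₁ δ)) => γ.curve)
      (fun δ => SAW.law D.carrier δ (a₁ δ) (b₁ δ)) μ := ⟨s, hs, hlim₁⟩
  obtain ⟨φ, hφ⟩ := MarkedDomain.exists_isChordalUniformizing_holds D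
  have hdesc := hR D a₁ b₁ hroot.1 φ hφ μ hμ hsub
  obtain ⟨𝓕, hW, hN⟩ := hA hD
    (fun D δ a a' b z φ _ _ V T θ S₀ s₁ t₁ => stub_paraExplorationData D δ a a' b z φ V T θ S₀ s₁ t₁)
    stub_paraDoobMartingale hO
    (Summit.CriticalPhenomena.SAWScalingLimit.Theorems.SubseqIdentification.RoomEntropy.stub_sawNoReturn hR)
    D a₁ a₁' b₁ φ μ hroot hφ hμ hsub hdesc
  exact stub_paraObservableCharacterisesSLECap D φ μ hφ hμ hdesc 𝓕 hW hN

/-- The same reduction for the decl of the route carrying the room line (`SAWRenewalTightness`, identical text). -/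
theorem SubseqIdentification_of_paraObservable' :
    (∀ (D : DobrushinDomain) (a a' b : ℝ → Site 2) (φ : ConformalEquiv upperHalfPlaneSet D.carrier),
        IsLatticeRooted D a a' b → D.IsChordalUniformizing φ →
        ∀ w : ℂ, 0 < w.im → ∀ (zδ : ℝ → Site 2),
          Tendsto (fun δ => meshPoint δ (zδ δ)) (𝓝[>] (0 : ℝ)) (𝓝 (φ w)) →
          (∃ C : ℝ, ∀ᶠ δ in 𝓝[>] (0 : ℝ), ∀ (γ : SAW.DomainSAW D.carrier δ (a δ) (b δ)) (k : ℕ),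
              LatticeSlit.capTime φ (prefixAt γ k) ≤ w.im ^ 2 / 16 →
              ‖paraDoob D δ (a δ) (a' δ) (b δ) (zδ δ) γ k‖ ≤ C) ∧
          ∀ ε : ℝ, 0 < ε → ∃ R : ℝ, 0 < R ∧ ∀ r : ℝ, 0 < r → r < R → ∀ᶠ δ in 𝓝[>] (0 : ℝ),
            ∀ (γ : SAW.DomainSAW D.carrier δ (a δ) (b δ)), γ ∉ noReturnEvent D δ (a δ) (b δ) R r →
              ∀ k : ℕ, LatticeSlit.capTime φ (prefixAt γ k) ≤ w.im ^ 2 / 16 →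
                ‖paraDoob D δ (a δ) (a' δ) (b δ) (zδ δ) γ k -
                    hullParaObs (LatticeSlit.pastHull φ (prefixAt γ k)) (LatticeSlit.drivingValue φ (prefixAt γ k)) w‖
                  ≤ ε) →
    (∀ (D : DobrushinDomain) (a b : ℝ → Site 2) (φ : ConformalEquiv upperHalfPlaneSet D.carrier),
          SAW.IsEndpointApprox D a b → D.IsChordalUniformizing φ →
          ∀ ρ : ℝ, 0 < ρ → ∀ (μ : Measure (CurveClass ℂ)) (s : ℕ → ℝ) [IsProbabilityMeasure μ]
            [∀ n, IsProbabilityMeasure (SAW.law D.carrier (s n) (a (s n)) (b (s n)))],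
            Tendsto s atTop (𝓝[>] (0 : ℝ)) → WeakLimitAlong D a b μ s →
            (∀ᵐ c ∂μ, IsLoewnerDescribable φ c ∧ c.source = D.pt 0) → NoReturnAlong D a b s →
            ∃ S₀ : ℝ≥0, 0 < S₀ ∧ (S₀ : ℝ) ≤ ρ ∧
            ∃ 𝒱 : (δ : ℝ) → SAW.DomainSAW D.carrier δ (a δ) (b δ) → C(ℝ≥0, ℝ),
              (∀ᶠ n in atTop, ∀ (γ γ' : SAW.DomainSAW D.carrier (s n) (a (s n)) (b (s n))) (k : ℕ),
                (prefixAt γ k).support = (prefixAt γ' k).support →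
                (S₀ : ℝ) ≤ LatticeSlit.capTime φ (prefixAt γ k) →
                ∀ u : ℝ≥0, (u : ℝ) ≤ LatticeSlit.capTime φ (prefixAt γ k) →
                  𝒱 (s n) γ u = 𝒱 (s n) γ' u) ∧
              TendstoInDistribution (fun n γ => 𝒱 (s n) γ) atTop (frozenDriver φ S₀)
                (fun n => SAW.law D.carrier (s n) (a (s n)) (b (s n))) μ ∧
              (∀ w : ℂ, ρ ≤ w.im → ∀ᶠ n in atTop,
                SAW.law D.carrier (s n) (a (s n)) (b (s n))
                  {γ | ∃ k : ℕ, (S₀ : ℝ) ≤ LatticeSlit.capTime φ (prefixAt γ k) ∧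
                    LatticeSlit.capTime φ (prefixAt γ k) ≤ w.im ^ 2 / 16 ∧
                    ρ < ‖paraObsCap (𝒱 (s n) γ) w (LatticeSlit.capTime φ (prefixAt γ k)).toNNReal -
                      hullParaObs (LatticeSlit.pastHull φ (prefixAt γ k))
                        (LatticeSlit.drivingValue φ (prefixAt γ k)) w‖}
                  ≤ ENNReal.ofReal ρ) ∧
              ∀ T ε : ℝ, 0 < ε → ∀ᶠ n in atTop,
                SAW.law D.carrier (s n) (a (s n)) (b (s n))
                  {γ | (∀ k : ℕ, LatticeSlit.capTime φ (prefixAt γ k) ≤ T) ∨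
                    ∃ (k : ℕ) (u : Site 2), LatticeSlit.capTime φ (prefixAt γ k) ≤ T ∧
                      ε < LatticeSlit.capIncrement φ (prefixAt γ k) u} ≤ ENNReal.ofReal ε) →
    ((∀ (D : DobrushinDomain) (a b : ℝ → Site 2) (φ : ConformalEquiv upperHalfPlaneSet D.carrier),
            SAW.IsEndpointApprox D a b → D.IsChordalUniformizing φ →
            ∀ ρ : ℝ, 0 < ρ → ∀ (μ : Measure (CurveClass ℂ)) (s : ℕ → ℝ) [IsProbabilityMeasure μ]
              [∀ n, IsProbabilityMeasure (SAW.law D.carrier (s n) (a (s n)) (b (s n)))],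
              Tendsto s atTop (𝓝[>] (0 : ℝ)) → WeakLimitAlong D a b μ s →
              (∀ᵐ c ∂μ, IsLoewnerDescribable φ c ∧ c.source = D.pt 0) → NoReturnAlong D a b s →
              ∃ S₀ : ℝ≥0, 0 < S₀ ∧ (S₀ : ℝ) ≤ ρ ∧
              ∃ 𝒱 : (δ : ℝ) → SAW.DomainSAW D.carrier δ (a δ) (b δ) → C(ℝ≥0, ℝ),
                (∀ᶠ n in atTop, ∀ (γ γ' : SAW.DomainSAW D.carrier (s n) (a (s n)) (b (s n))) (k : ℕ),
                  (prefixAt γ k).support = (prefixAt γ' k).support →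
                  (S₀ : ℝ) ≤ LatticeSlit.capTime φ (prefixAt γ k) →
                  ∀ u : ℝ≥0, (u : ℝ) ≤ LatticeSlit.capTime φ (prefixAt γ k) →
                    𝒱 (s n) γ u = 𝒱 (s n) γ' u) ∧
                TendstoInDistribution (fun n γ => 𝒱 (s n) γ) atTop (frozenDriver φ S₀)
                  (fun n => SAW.law D.carrier (s n) (a (s n)) (b (s n))) μ ∧
                (∀ w : ℂ, ρ ≤ w.im → ∀ᶠ n in atTop,
                  SAW.law D.carrier (s n) (a (s n)) (b (s n))
                    {γ | ∃ k : ℕ, (S₀ : ℝ) ≤ LatticeSlit.capTime φ (prefixAt γ k) ∧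
                      LatticeSlit.capTime φ (prefixAt γ k) ≤ w.im ^ 2 / 16 ∧
                      ρ < ‖paraObsCap (𝒱 (s n) γ) w (LatticeSlit.capTime φ (prefixAt γ k)).toNNReal -
                        hullParaObs (LatticeSlit.pastHull φ (prefixAt γ k))
                          (LatticeSlit.drivingValue φ (prefixAt γ k)) w‖}
                    ≤ ENNReal.ofReal ρ) ∧
                ∀ T ε : ℝ, 0 < ε → ∀ᶠ n in atTop,
                  SAW.law D.carrier (s n) (a (s n)) (b (s n))
                    {γ | (∀ k : ℕ, LatticeSlit.capTime φ (prefixAt γ k) ≤ T) ∨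
                      ∃ (k : ℕ) (u : Site 2), LatticeSlit.capTime φ (prefixAt γ k) ≤ T ∧
                        ε < LatticeSlit.capIncrement φ (prefixAt γ k) u} ≤ ENNReal.ofReal ε) →
      (∀ (D : DobrushinDomain) (δ : ℝ) (a a' b z : Site 2)
            (φ : ConformalEquiv upperHalfPlaneSet D.carrier)
            [Finite (SAW.DomainSAW D.carrier δ a b)] [IsProbabilityMeasure (SAW.law D.carrier δ a b)]
            (V : SAW.DomainSAW D.carrier δ a b → C(ℝ≥0, ℝ)) (T θ : ℝ) (S₀ s₁ t₁ : ℝ≥0),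
            0 ≤ θ → 0 < S₀ → S₀ ≤ s₁ → s₁ ≤ t₁ → (t₁ : ℝ) + 2 * θ ≤ T →
            (∀ (n : ℕ) (l : List (Site 2)), z ∉ l → l.length = n + 1 →
              (∀ v u : Site 2, l.getLast? = some v → (discreteDomainGraph D.carrier δ).Adj v u → u ∉ l →
                (∃ ω : SAW.DomainSAW D.carrier δ u z, ∀ y ∈ ω.walk.support, y ∉ l) →
                ∃ ω : SAW.DomainSAW D.carrier δ u b, ∀ y ∈ ω.walk.support, y ∉ l) →
              ∫ γ in {γ : SAW.DomainSAW D.carrier δ a b | γ.walk.support.take (n + 1) = l},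
                  paraDoob D δ a a' b z γ (n + 1) ∂(SAW.law D.carrier δ a b) =
                ∫ γ in {γ : SAW.DomainSAW D.carrier δ a b | γ.walk.support.take (n + 1) = l},
                  paraDoob D δ a a' b z γ n ∂(SAW.law D.carrier δ a b)) →
            (∀ γ : SAW.DomainSAW D.carrier δ a b, LatticeSlit.capTime φ (prefixAt γ 0) ≤ θ) →
            (∀ (γ γ' : SAW.DomainSAW D.carrier δ a b) (k : ℕ),
              (prefixAt γ k).support = (prefixAt γ' k).support →
              (S₀ : ℝ) ≤ LatticeSlit.capTime φ (prefixAt γ k) →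
              ∀ u : ℝ≥0, (u : ℝ) ≤ LatticeSlit.capTime φ (prefixAt γ k) → V γ u = V γ' u) →
            ∃ (𝒢 : Filtration ℕ (inferInstance : MeasurableSpace (SAW.DomainSAW D.carrier δ a b)))
              (σ τ : SAW.DomainSAW D.carrier δ a b → WithTop ℕ) (hσ : IsStoppingTime 𝒢 σ) (M : ℕ)
              (G : ℕ → SAW.DomainSAW D.carrier δ a b → ℂ),
              IsStoppingTime 𝒢 τ ∧ Martingale G 𝒢 (SAW.law D.carrier δ a b) ∧ σ ≤ τ ∧ (∀ γ, τ γ ≤ M) ∧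
              (∀ u, u ≤ s₁ → Measurable[hσ.measurableSpace] fun γ => V γ u) ∧
              (∀ (n : ℕ) (γ : SAW.DomainSAW D.carrier δ a b), ∃ k : ℕ,
                G n γ = paraDoob D δ a a' b z γ k ∧ LatticeSlit.capTime φ (prefixAt γ k) ≤ T) ∧
              ∀ γ : SAW.DomainSAW D.carrier δ a b,
                γ ∉ {γ : SAW.DomainSAW D.carrier δ a b |
                      (∀ k : ℕ, LatticeSlit.capTime φ (prefixAt γ k) ≤ T) ∨
                      ∃ (k : ℕ) (u : Site 2), LatticeSlit.capTime φ (prefixAt γ k) ≤ T ∧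
                        θ < LatticeSlit.capIncrement φ (prefixAt γ k) u} →
                ∃ j k : ℕ, σ γ = j ∧ τ γ = k ∧
                  (s₁ : ℝ) ≤ LatticeSlit.capTime φ (prefixAt γ j) ∧
                  LatticeSlit.capTime φ (prefixAt γ j) ≤ s₁ + θ ∧
                  (t₁ : ℝ) ≤ LatticeSlit.capTime φ (prefixAt γ k) ∧
                  LatticeSlit.capTime φ (prefixAt γ k) ≤ t₁ + θ ∧
                  (stoppedValue G σ γ = paraDoob D δ a a' b z γ j ∧
                      stoppedValue G τ γ = paraDoob D δ a a' b z γ k ∨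
                    paraDoob D δ a a' b z γ k = 0)) →
      (∀ (D : DobrushinDomain) (δ : ℝ) (a a' b z : Site 2) (n : ℕ) (l : List (Site 2)), 0 < δ → z ∉ l →
          l.length = n + 1 →
          (∀ v u : Site 2, l.getLast? = some v → (discreteDomainGraph D.carrier δ).Adj v u → u ∉ l →
            (∃ ω : SAW.DomainSAW D.carrier δ u z, ∀ y ∈ ω.walk.support, y ∉ l) →
            ∃ ω : SAW.DomainSAW D.carrier δ u b, ∀ y ∈ ω.walk.support, y ∉ l) →
          ∫ γ in {γ : SAW.DomainSAW D.carrier δ a b | γ.walk.support.take (n + 1) = l},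
              paraDoob D δ a a' b z γ (n + 1) ∂(SAW.law D.carrier δ a b) =
            ∫ γ in {γ : SAW.DomainSAW D.carrier δ a b | γ.walk.support.take (n + 1) = l},
              paraDoob D δ a a' b z γ n ∂(SAW.law D.carrier δ a b)) →
      (∀ (D : DobrushinDomain) (a a' b : ℝ → Site 2) (φ : ConformalEquiv upperHalfPlaneSet D.carrier),
          IsLatticeRooted D a a' b → D.IsChordalUniformizing φ →
          ∀ w : ℂ, 0 < w.im → ∀ (zδ : ℝ → Site 2),
            Tendsto (fun δ => meshPoint δ (zδ δ)) (𝓝[>] (0 : ℝ)) (𝓝 (φ w)) →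
            (∃ C : ℝ, ∀ᶠ δ in 𝓝[>] (0 : ℝ), ∀ (γ : SAW.DomainSAW D.carrier δ (a δ) (b δ)) (k : ℕ),
                LatticeSlit.capTime φ (prefixAt γ k) ≤ w.im ^ 2 / 16 →
                ‖paraDoob D δ (a δ) (a' δ) (b δ) (zδ δ) γ k‖ ≤ C) ∧
            ∀ ε : ℝ, 0 < ε → ∃ R : ℝ, 0 < R ∧ ∀ r : ℝ, 0 < r → r < R → ∀ᶠ δ in 𝓝[>] (0 : ℝ),
              ∀ (γ : SAW.DomainSAW D.carrier δ (a δ) (b δ)), γ ∉ noReturnEvent D δ (a δ) (b δ) R r →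
                ∀ k : ℕ, LatticeSlit.capTime φ (prefixAt γ k) ≤ w.im ^ 2 / 16 →
                  ‖paraDoob D δ (a δ) (a' δ) (b δ) (zδ δ) γ k -
                      hullParaObs (LatticeSlit.pastHull φ (prefixAt γ k)) (LatticeSlit.drivingValue φ (prefixAt γ k)) w‖
                    ≤ ε) →
      (∀ (D : DobrushinDomain) (a b : ℝ → Site 2), SAW.IsEndpointApprox D a b →
            ∀ (μ : Measure (CurveClass ℂ)) (s : ℕ → ℝ), IsProbabilityMeasure μ →
              Tendsto s atTop (𝓝[>] (0 : ℝ)) → WeakLimitAlong D a b μ s → NoReturnAlong D a b s) →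
      ∀ (D : DobrushinDomain) (a a' b : ℝ → Site 2)
          (φ : ConformalEquiv upperHalfPlaneSet D.carrier) (μ : Measure (CurveClass ℂ)),
          IsLatticeRooted D a a' b → D.IsChordalUniformizing φ → IsProbabilityMeasure μ →
          IsSubseqLimitLaw (fun δ (γ : SAW.DomainSAW D.carrier δ (a δ) (b δ)) => γ.curve)
            (fun δ => SAW.law D.carrier δ (a δ) (b δ)) μ →
          (∀ᵐ c ∂μ, IsLoewnerDescribable φ c ∧ c.source = D.pt 0) →
          ∃ 𝓕 : Filtration ℝ≥0 (inferInstance : MeasurableSpace (CurveClass ℂ)),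
            Adapted 𝓕 (fun t c => drivingFunction φ c t) ∧
            ∀ w : ℂ, 0 < w.im →
              Martingale (fun t c => paraObsCap (drivingFunction φ c) w t) 𝓕 μ) →
    LimitsDescribable → EndpointRobust →
      Summit.CriticalPhenomena.SAWScalingLimit.Theses.SAWRenewalTightness.SubseqIdentification :=
  SubseqIdentification_of_paraObservable

end Summit.CriticalPhenomena.SAWScalingLimit.Theorems.SubseqIdentification.ParaMartingale

end
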